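import Literature.Analysis.FluidPDE.AxisymOuterBounds
import Literature.Analysis.FluidPDE.AxisymPoloidalMoments
import HarnessLib

/-!
# Wei 2016, §3: the far-field bound `∫_{r ≥ r(t)/2} |∇(u_r/r)|² ≤ C r(t)⁻² ∫ |∇u|²`

Analysis/FluidPDE proof file (theorems only; no definitions, no named facts) on the way to
`Literature.Analysis.FluidPDE.Wei2016_logModulus_regularity`
(`LeiZhang2017AxisymmetricCriteria.lean`), after D. Wei, J. Math. Anal. Appl. 435 (2016) =
arXiv:1508.03318, §3, p. 7: "By Lemma 2.1 and the fact that `∇(u_r/r) = ∇u_r/r − u_r e_r/r²`,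
`|∇u|² = |∇u_r|² + |∇u_θ|² + |∇u_z|² + |u_r/r|² + |u_θ/r|²`, we obtain …
`∫_{r ≥ r(t)/2}(|∇(u_r/r)|² + Ω² + J²) dx ≤ (C/r(t)²) ∫|∇u|² dx`."

For `Ω = ω_θ/r`, `J = ω_r/r` the tree has `|Ω|, |J| ≤ ‖ω‖/r` and the outer integrals
(`AxisymOuterBounds`: `IsAxisymmetric.abs_angVortQuot_le_norm_curl_div`, `setIntegral_sq_le_of_abs_le_div`).
For `W = u_r/r = radVelQuot u` the tree's `IsAxisymmetric.norm_fderiv_radVelQuot_le`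
(`‖DW‖ ≤ 3‖u‖/r² + ‖Du‖/r`) carries a zeroth-order term `‖u‖/r²`, which after integration in time
would not be controlled by the energy dissipation alone; Wei's bound has **only `‖Du‖`** on the
right. This file proves that sharper pointwise bound and its outer integral:

* `Wei2016.abs_inner_horizontal_velocity_le` — `|v₀u₀ + v₁u₁| ≤ r ‖Du(x)‖ ‖v‖` for an axisymmetric
  `u` (the horizontal velocity has the size of `J u(x) = Du(x)[Jx]`, `|Jx| = r`);
* `Wei2016.abs_fderiv_radVelQuot_apply_le` — **`|DW(x)[v]| ≤ 4 ‖Du(x)‖ ‖v‖ / r`** off the axis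
  (differentiate `r²W = x₀u₀ + x₁u₁` along `v`:
  `2⟪x_h, v⟫W + r²DW[v] = (v₀u₀ + v₁u₁) + (x₀(Du v)₀ + x₁(Du v)₁)`, each term `≤ r‖Du‖‖v‖`,
  with `|W| ≤ ‖Du‖` from `AxisymQuotientBounds`);
* `Wei2016.setIntegral_gradSq_radVelQuot_le` — **`∫_{r > δ} Σᵢ(∂ᵢW)² ≤ 48 δ⁻² ∫ ‖Du‖²`**.

## References

* D. Wei, arXiv:1508.03318, §3, p. 7 (the far-field bound). [Wei2016]
-/

noncomputable section

open MeasureTheory Set Function Filter WithLp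
open scoped RealInnerProductSpace

namespace Literature.Analysis.FluidPDE

namespace Wei2016

variable {u : EuclideanSpace ℝ (Fin 3) → EuclideanSpace ℝ (Fin 3)}

/-- `v₀² + v₁² ≤ ‖v‖²` on `ℝ³`. [folklore] -/
theorem sq_add_sq_le_norm_sq (w : EuclideanSpace ℝ (Fin 3)) : w 0 ^ 2 + w 1 ^ 2 ≤ ‖w‖ ^ 2 := by
  have hn : ‖w‖ ^ 2 = w 0 ^ 2 + w 1 ^ 2 + w 2 ^ 2 := by
    rw [EuclideanSpace.norm_eq, Real.sq_sqrt (by positivity), Fin.sum_univ_three]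
    simp only [Real.norm_eq_abs, sq_abs]
  nlinarith [sq_nonneg (w 2)]

/-- **The horizontal velocity against an arbitrary direction**: `|v₀u₀ + v₁u₁| ≤ r ‖Du(x)‖ ‖v‖` for
an axisymmetric `u` differentiable at `x` (`√(u₀² + u₁²) ≤ r‖Du(x)‖`,
`IsAxisymmetric.sqrt_sq_add_sq_le_mul_norm_fderiv`, and Cauchy–Schwarz). [folklore] -/
theorem abs_inner_horizontal_velocity_le (hax : IsAxisymmetric u) {x : EuclideanSpace ℝ (Fin 3)}
    (hd : DifferentiableAt ℝ u x) (v : EuclideanSpace ℝ (Fin 3)) :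
    |v 0 * u x 0 + v 1 * u x 1| ≤ cylRadius x * ‖fderiv ℝ u x‖ * ‖v‖ := by
  have hh := hax.sqrt_sq_add_sq_le_mul_norm_fderiv hd
  have h0 : 0 ≤ cylRadius x * ‖fderiv ℝ u x‖ := mul_nonneg (cylRadius_nonneg x) (norm_nonneg _)
  have hn : u x 0 ^ 2 + u x 1 ^ 2 ≤ (cylRadius x * ‖fderiv ℝ u x‖) ^ 2 := by
    have h := pow_le_pow_left₀ (Real.sqrt_nonneg _) hh 2
    rwa [Real.sq_sqrt (by positivity)] at h
  have hsq : (v 0 * u x 0 + v 1 * u x 1) ^ 2 ≤ (cylRadius x * ‖fderiv ℝ u x‖ * ‖v‖) ^ 2 := by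
    have hcs : (v 0 * u x 0 + v 1 * u x 1) ^ 2 ≤ (v 0 ^ 2 + v 1 ^ 2) * (u x 0 ^ 2 + u x 1 ^ 2) := by
      nlinarith [sq_nonneg (v 0 * u x 1 - v 1 * u x 0)]
    calc (v 0 * u x 0 + v 1 * u x 1) ^ 2 ≤ (v 0 ^ 2 + v 1 ^ 2) * (u x 0 ^ 2 + u x 1 ^ 2) := hcs
      _ ≤ ‖v‖ ^ 2 * (cylRadius x * ‖fderiv ℝ u x‖) ^ 2 :=
          mul_le_mul (sq_add_sq_le_norm_sq v) hn (by positivity) (sq_nonneg _)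
      _ = (cylRadius x * ‖fderiv ℝ u x‖ * ‖v‖) ^ 2 := by ring
  exact abs_le.2 (abs_le_of_sq_le_sq' hsq (mul_nonneg h0 (norm_nonneg _)))

/-- **`|DW(x)[v]| ≤ 4 ‖Du(x)‖ ‖v‖ / r` off the axis** (`W = u_r/r = radVelQuot u`, `u ∈ C³`
axisymmetric). Differentiating `r² W = x₀u₀ + x₁u₁` along `v`:
`2⟪x_h, v⟫ W + r² DW[v] = (v₀u₀ + v₁u₁) + (x₀(Du v)₀ + x₁(Du v)₁)`, and each of
`|v₀u₀ + v₁u₁|`, `|x₀(Du v)₀ + x₁(Du v)₁|`, `|⟪x_h, v⟫ W|` is `≤ r‖Du‖‖v‖`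
(`abs_inner_horizontal_velocity_le`, `abs_horizontal_inner_le_cylRadius_mul`,
`IsAxisymmetric.abs_radVelQuot_le_norm_fderiv`). This is Wei's
"`∇(u_r/r) = ∇u_r/r − u_r e_r/r²`" with `|∇u|² ≥ |∇u_r|² + |u_r/r|²`.
[cite: Wei2016, §3 p. 7 (far-field bound)] -/
theorem abs_fderiv_radVelQuot_apply_le (hax : IsAxisymmetric u) (hu3 : ContDiff ℝ 3 u)
    {x : EuclideanSpace ℝ (Fin 3)} (hx : cylRadius x ≠ 0) (v : EuclideanSpace ℝ (Fin 3)) :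
    |fderiv ℝ (radVelQuot u) x v| ≤ 4 * ‖fderiv ℝ u x‖ * ‖v‖ / cylRadius x := by
  have hu : ContDiff ℝ 2 u := hu3.of_le (by norm_num)
  have hr : 0 < cylRadius x := lt_of_le_of_ne (cylRadius_nonneg x) (Ne.symm hx)
  have hd : Differentiable ℝ u := hu.differentiable two_ne_zero
  have hW : Differentiable ℝ (radVelQuot u) :=
    (contDiff_radVelQuot (n := 1) (by exact_mod_cast hu3)).differentiable one_ne_zero
  -- the identity `r² W = x₀u₀ + x₁u₁` as functions, differentiated along `v`
  have hfun : (fun y => cylRadius y ^ 2 * radVelQuot u y) = fun y => y 0 * u y 0 + y 1 * u y 1 :=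
    funext fun y => hax.cylRadius_sq_mul_radVelQuot hu y
  have hD := congrArg (fun F => fderiv ℝ F x v) hfun
  beta_reduce at hD
  have hr2 := hasFDerivAt_cylRadius_sq x
  rw [fderiv_fun_mul hr2.differentiableAt (hW x), hr2.fderiv] at hD
  -- right side: coordinates
  have hc : ∀ i : Fin 3, HasFDerivAt (fun y : EuclideanSpace ℝ (Fin 3) => (y i : ℝ))
      (EuclideanSpace.proj (𝕜 := ℝ) i : EuclideanSpace ℝ (Fin 3) →L[ℝ] ℝ) x := fun i =>
    (EuclideanSpace.proj (𝕜 := ℝ) i).hasFDerivAt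
  have hui : ∀ i : Fin 3, HasFDerivAt (fun y => u y i)
      ((EuclideanSpace.proj (𝕜 := ℝ) i : EuclideanSpace ℝ (Fin 3) →L[ℝ] ℝ).comp (fderiv ℝ u x)) x :=
    fun i => (EuclideanSpace.proj (𝕜 := ℝ) i).hasFDerivAt.comp x (hd x).hasFDerivAt
  have hR : HasFDerivAt (fun y : EuclideanSpace ℝ (Fin 3) => y 0 * u y 0 + y 1 * u y 1)
      (x 0 • ((EuclideanSpace.proj (𝕜 := ℝ) 0 : EuclideanSpace ℝ (Fin 3) →L[ℝ] ℝ).comp (fderiv ℝ u x)) +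
        u x 0 • (EuclideanSpace.proj (𝕜 := ℝ) 0 : EuclideanSpace ℝ (Fin 3) →L[ℝ] ℝ) +
        (x 1 • ((EuclideanSpace.proj (𝕜 := ℝ) 1 : EuclideanSpace ℝ (Fin 3) →L[ℝ] ℝ).comp (fderiv ℝ u x)) +
          u x 1 • (EuclideanSpace.proj (𝕜 := ℝ) 1 : EuclideanSpace ℝ (Fin 3) →L[ℝ] ℝ))) x :=
    ((hc 0).mul (hui 0)).add ((hc 1).mul (hui 1))
  rw [hR.fderiv] at hD
  simp only [_root_.add_apply, _root_.smul_apply, smul_eq_mul, ContinuousLinearMap.comp_apply,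
    PiLp.proj_apply] at hD
  have hE : cylRadius x ^ 2 * fderiv ℝ (radVelQuot u) x v =
      (v 0 * u x 0 + v 1 * u x 1) + (x 0 * fderiv ℝ u x v 0 + x 1 * fderiv ℝ u x v 1) -
        2 * (x 0 * v 0 + x 1 * v 1) * radVelQuot u x := by
    linarith
  -- the three bounds
  have h1 := abs_inner_horizontal_velocity_le hax (hd x) v
  have h2 : |x 0 * fderiv ℝ u x v 0 + x 1 * fderiv ℝ u x v 1| ≤ cylRadius x * (‖fderiv ℝ u x‖ * ‖v‖) := by
    have h := abs_horizontal_inner_le_cylRadius_mul x (fderiv ℝ u x v)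
    exact h.trans (mul_le_mul_of_nonneg_left (ContinuousLinearMap.le_opNorm _ _) hr.le)
  have h3 : |2 * (x 0 * v 0 + x 1 * v 1) * radVelQuot u x| ≤ 2 * (cylRadius x * ‖v‖) * ‖fderiv ℝ u x‖ := by
    rw [abs_mul, abs_mul, abs_two]
    have hv : |x 0 * v 0 + x 1 * v 1| ≤ cylRadius x * ‖v‖ := abs_horizontal_inner_le_cylRadius_mul x v
    have hWb := hax.abs_radVelQuot_le_norm_fderiv hu x
    gcongr
  have htot : cylRadius x ^ 2 * |fderiv ℝ (radVelQuot u) x v| ≤ 4 * (cylRadius x * ‖fderiv ℝ u x‖ * ‖v‖) := by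
    rw [← abs_of_pos (pow_pos hr 2), ← abs_mul, hE]
    calc |v 0 * u x 0 + v 1 * u x 1 + (x 0 * fderiv ℝ u x v 0 + x 1 * fderiv ℝ u x v 1) -
          2 * (x 0 * v 0 + x 1 * v 1) * radVelQuot u x|
        ≤ |v 0 * u x 0 + v 1 * u x 1| + |x 0 * fderiv ℝ u x v 0 + x 1 * fderiv ℝ u x v 1| +
          |2 * (x 0 * v 0 + x 1 * v 1) * radVelQuot u x| :=
          (abs_sub _ _).trans (add_le_add (abs_add_le _ _) le_rfl)
      _ ≤ 4 * (cylRadius x * ‖fderiv ℝ u x‖ * ‖v‖) := by nlinarith [h1, h2, h3]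
  rw [le_div_iff₀ hr]
  nlinarith [htot, abs_nonneg (fderiv ℝ (radVelQuot u) x v), hr]

/-- **`∫_{r > δ} Σᵢ (∂ᵢW)² ≤ 48 δ⁻² ∫ ‖Du‖²`** (`W = u_r/r`) for an axisymmetric `u ∈ C³` with
`Du ∈ L²` and `Σᵢ(∂ᵢW)²` integrable on the outer region: `(∂ᵢW)² ≤ 16‖Du‖²/r²` there
(`abs_fderiv_radVelQuot_apply_le` with `v = eᵢ`). [cite: Wei2016, §3 p. 7 (far-field bound)] -/
theorem setIntegral_gradSq_radVelQuot_le (hax : IsAxisymmetric u) (hu3 : ContDiff ℝ 3 u)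
    {δ : ℝ} (hδ : 0 < δ)
    (hWi : IntegrableOn (fun x => fderiv ℝ (radVelQuot u) x (EuclideanSpace.single 0 1) ^ 2 +
      fderiv ℝ (radVelQuot u) x (EuclideanSpace.single 1 1) ^ 2 +
      fderiv ℝ (radVelQuot u) x (EuclideanSpace.single 2 1) ^ 2) {x | δ < cylRadius x})
    (hu1 : Integrable (fun x => ‖fderiv ℝ u x‖ ^ 2)) :
    ∫ x in {x | δ < cylRadius x}, (fderiv ℝ (radVelQuot u) x (EuclideanSpace.single 0 1) ^ 2 +
        fderiv ℝ (radVelQuot u) x (EuclideanSpace.single 1 1) ^ 2 +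
        fderiv ℝ (radVelQuot u) x (EuclideanSpace.single 2 1) ^ 2) ≤
      48 / δ ^ 2 * ∫ x, ‖fderiv ℝ u x‖ ^ 2 := by
  have hmaj : Integrable (fun x => 48 / δ ^ 2 * ‖fderiv ℝ u x‖ ^ 2) := hu1.const_mul _
  -- pointwise on the outer region
  have hpt : ∀ x, δ < cylRadius x →
      fderiv ℝ (radVelQuot u) x (EuclideanSpace.single 0 1) ^ 2 +
        fderiv ℝ (radVelQuot u) x (EuclideanSpace.single 1 1) ^ 2 +
        fderiv ℝ (radVelQuot u) x (EuclideanSpace.single 2 1) ^ 2 ≤ 48 / δ ^ 2 * ‖fderiv ℝ u x‖ ^ 2 := by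
    intro x hx
    have hr : 0 < cylRadius x := hδ.trans hx
    have hone : ∀ i : Fin 3, fderiv ℝ (radVelQuot u) x (EuclideanSpace.single i 1) ^ 2 ≤
        16 / δ ^ 2 * ‖fderiv ℝ u x‖ ^ 2 := by
      intro i
      have h := abs_fderiv_radVelQuot_apply_le hax hu3 hr.ne' (EuclideanSpace.single i (1 : ℝ))
      have hn1 : ‖(EuclideanSpace.single i (1 : ℝ) : EuclideanSpace ℝ (Fin 3))‖ = 1 := by simp
      rw [hn1, mul_one] at h
      -- `|a| ≤ 4‖Du‖/r ≤ 4‖Du‖/δ`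
      have h' : |fderiv ℝ (radVelQuot u) x (EuclideanSpace.single i 1)| ≤ 4 * ‖fderiv ℝ u x‖ / δ :=
        h.trans (div_le_div_of_nonneg_left (by positivity) hδ hx.le)
      have hsq := pow_le_pow_left₀ (abs_nonneg _) h' 2
      rw [sq_abs] at hsq
      refine hsq.trans (le_of_eq ?_)
      field_simp
      ring
    have h0 := hone 0
    have h1 := hone 1
    have h2 := hone 2
    have h48 : 48 / δ ^ 2 * ‖fderiv ℝ u x‖ ^ 2 = 3 * (16 / δ ^ 2 * ‖fderiv ℝ u x‖ ^ 2) := by ring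
    linarith
  have h1 : ∫ x in {x | δ < cylRadius x}, (fderiv ℝ (radVelQuot u) x (EuclideanSpace.single 0 1) ^ 2 +
        fderiv ℝ (radVelQuot u) x (EuclideanSpace.single 1 1) ^ 2 +
        fderiv ℝ (radVelQuot u) x (EuclideanSpace.single 2 1) ^ 2) ≤
      ∫ x in {x | δ < cylRadius x}, 48 / δ ^ 2 * ‖fderiv ℝ u x‖ ^ 2 :=
    setIntegral_mono_on hWi hmaj.integrableOn (measurableSet_lt_cylRadius δ) fun x hx => hpt x hx
  refine h1.trans ?_
  have h2 := setIntegral_le_integral (s := {x | δ < cylRadius x}) hmaj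
    (Eventually.of_forall fun x => by positivity)
  refine h2.trans (le_of_eq ?_)
  rw [integral_const_mul]

end Wei2016

end Literature.Analysis.FluidPDE

end
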